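import Summits.HubbardSuperconductivity.HubbardSuperconductivity.Theorems.AnisotropyChordStiffnessDoobNetwork

/-!
# Route `AnisotropyChord` / H0 rotor rung: THE DOOB DICTIONARY IS EXACT — `DoobWindingStiffness ↔ VariationalTwistStiffness`
# (port of theory seat `hubbard-h0-rotor-theory-1`, cycle 10, `Sketch10.lean` Part F, memo ROTOR-THEORY-10 §137; work-order v8)

Converse of `…StiffnessDoobNetwork`: a winding-energy floor `Υ/2 ≤ W_j(a; g)` for every real potential `g` gives back the
φ-form twist stiffness at level `Υ` (`Υ ≤ ⟨−T_j⟩` and `2|⟨φ, J^j_0 ψ⟩|² ≤ (⟨−T_j⟩ − Υ) Re⟨φ,(H−E₀)φ⟩` on the sector):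
* scaling lemmas `dirichletEnergy_smul`, `windingPairing_smul`, `…_zero`; `pairing_sq_le_of_floor` (`2B_j(g)² ≤ (K − Υ)Q(g)`
  by optimising the drive), `le_kineticExpect_of_floor`;
* `shiftedForm_eq_dirichlet_re_im`, `currentForm_eq_pairing_re_im` — a general complex sector test vector `φ = (g₁ + i g₂)ψ`
  splits into two real potentials (`Re⟨φ,(H−E₀)φ⟩ = Q(g₁) + Q(g₂)`, `⟨φ, J^j_0ψ⟩ = B_j(g₂) − i B_j(g₁)`);
* **`variational_of_windingEnergy_ge`** and the dictionary theorems **`doobWindingStiffness_iff_variational`**,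
  **`doobWindingStiffnessN_iff_variationalN`**: hypothesis (S_tw) of H0 is EXACTLY a Dirichlet-principle floor on the
  winding conductance of the Doob configuration network.
Typing/proof authority: theory seat `hubbard-h0-rotor-theory-1`, cycle 10.
-/

set_option linter.dupNamespace false

noncomputable section

open Matrix Complex Finset Filter Topology
open scoped ComplexConjugate
open Literature.MathematicalPhysics.QuantumLattice hiding torusPhase torusNorm
open Literature.Probability.LatticeModels
open Summit.HubbardSuperconductivity.HubbardSuperconductivity.Theorems.AnisotropyChord.InsertionEntropy
  (torusPhase norm_torusPhase IsPerronSectorGroundAmplitude)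
open Summit.HubbardSuperconductivity.HubbardSuperconductivity.Theorems.AnisotropyChord.Stiffness

namespace Summit.HubbardSuperconductivity.HubbardSuperconductivity.Theorems.AnisotropyChord.Stiffness.Doob

variable {L : ℕ} [NeZero L]

/-! ## F. THE CONVERSE: the winding-energy floor is EQUIVALENT to the φ-form (exact dictionary) -/

/-- Scaling: `Q(t g) = t² Q(g)`. [folklore] -/
theorem dirichletEnergy_smul (a : TensorIndex (TorusSite 2 L) 2 → ℝ) (t : ℝ)
    (g : TensorIndex (TorusSite 2 L) 2 → ℝ) :
    dirichletEnergy a (fun σ => t * g σ) = t ^ 2 * dirichletEnergy a g := by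
  unfold dirichletEnergy bondDirichlet
  simp only [Finset.mul_sum]
  refine Finset.sum_congr rfl fun p _ => Finset.sum_congr rfl fun σ _ => ?_
  split_ifs <;> ring

/-- Scaling: `B_j(t g) = t B_j(g)`. [folklore] -/
theorem windingPairing_smul (a : TensorIndex (TorusSite 2 L) 2 → ℝ) (j : Fin 2) (t : ℝ)
    (g : TensorIndex (TorusSite 2 L) 2 → ℝ) :
    windingPairing a j (fun σ => t * g σ) = t * windingPairing a j g := by
  unfold windingPairing bondPairing
  simp only [Finset.mul_sum]
  refine Finset.sum_congr rfl fun x _ => Finset.sum_congr rfl fun σ _ => ?_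
  ring

/-- `Q(0) = 0`. [folklore] -/
theorem dirichletEnergy_zero (a : TensorIndex (TorusSite 2 L) 2 → ℝ) :
    dirichletEnergy a (fun _ => 0) = 0 := by
  have h := dirichletEnergy_smul a 0 (fun _ => 0)
  simp only [mul_zero, ne_eq, OfNat.ofNat_ne_zero, not_false_eq_true, zero_pow, zero_mul] at h
  exact h

/-- `B_j(0) = 0`. [folklore] -/
theorem windingPairing_zero (a : TensorIndex (TorusSite 2 L) 2 → ℝ) (j : Fin 2) :
    windingPairing a j (fun _ => 0) = 0 := by
  have h := windingPairing_smul a j 0 (fun _ => 0)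
  simp only [mul_zero, zero_mul] at h
  exact h

/-- **Real potentials: the floor gives the quadratic-form inequality** `2 B_j(g)² ≤ (⟨−T_j⟩ − Υ) Q(g)`
(test `t g` for all real `t`, discriminant). [folklore] -/
theorem pairing_sq_le_of_floor (hL : 2 ≤ L) (a : TensorIndex (TorusSite 2 L) 2 → ℝ) (j : Fin 2) (Υ : ℝ)
    (hW : ∀ g : TensorIndex (TorusSite 2 L) 2 → ℝ, Υ / 2 ≤ windingEnergy a j g)
    (g : TensorIndex (TorusSite 2 L) 2 → ℝ) :
    2 * windingPairing a j g ^ 2 ≤ (kineticExpect L a j - Υ) * dirichletEnergy a g := by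
  have hquad : ∀ t : ℝ, 0 ≤ dirichletEnergy a g * (t * t) + 2 * windingPairing a j g * t
      + (kineticExpect L a j - Υ) / 2 := by
    intro t
    have h := hW (fun σ => t * g σ)
    rw [windingEnergy_expand hL, dirichletEnergy_smul, windingPairing_smul] at h
    nlinarith [h]
  have hd := discrim_le_zero hquad
  rw [discrim] at hd
  nlinarith [hd]

/-- `Υ ≤ ⟨−T_j⟩` from the floor at `g = 0`. [folklore] -/
theorem le_kineticExpect_of_floor (hL : 2 ≤ L) (a : TensorIndex (TorusSite 2 L) 2 → ℝ) (j : Fin 2) (Υ : ℝ)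
    (hW : ∀ g : TensorIndex (TorusSite 2 L) 2 → ℝ, Υ / 2 ≤ windingEnergy a j g) :
    Υ ≤ kineticExpect L a j := by
  have h := hW (fun _ => 0)
  rw [windingEnergy_expand hL, dirichletEnergy_zero, windingPairing_zero] at h
  linarith

/-- `|z − w|² = (Re z − Re w)² + (Im z − Im w)²`. [folklore] -/
theorem norm_sub_sq_re_im (z w : ℂ) : ‖z - w‖ ^ 2 = (z.re - w.re) ^ 2 + (z.im - w.im) ^ 2 := by
  rw [Complex.sq_norm, Complex.normSq_apply, Complex.sub_re, Complex.sub_im]; ring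

/-- **General sector test vectors: the shifted form splits into the Dirichlet energies of the real and
imaginary parts of `u = φ/ψ`** (`L ≥ 3`). [folklore] -/
theorem shiftedForm_eq_dirichlet_re_im (hL : 3 ≤ L) (Δ M : ℝ) (a : TensorIndex (TorusSite 2 L) 2 → ℝ)
    (ha : IsPerronSectorGroundAmplitude L Δ M a) (φ : TensorIndex (TorusSite 2 L) 2 → ℂ)
    (hφ : φ ∈ spinZSector (Λ := TorusSite 2 L) 1 M) :
    (star φ ⬝ᵥ ((hcbHamiltonian L Δ
        - ((lowestEnergyInSector 1 (hcbHamiltonian L Δ) M : ℝ) : ℂ) • (1 : Op (TorusSite 2 L) 2)) *ᵥ φ)).re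
      = dirichletEnergy a (fun σ => (φ σ / (a σ : ℂ)).re) + dirichletEnergy a (fun σ => (φ σ / (a σ : ℂ)).im) := by
  set E₀ : ℝ := lowestEnergyInSector 1 (hcbHamiltonian L Δ) M with hE₀
  set u : TensorIndex (TorusSite 2 L) 2 → ℂ := fun σ => φ σ / (a σ : ℂ) with hu
  have hφu : ∀ σ, φ σ = u σ * (a σ : ℂ) := fun σ => sector_eq_mul_perron Δ M a ha φ hφ σ
  set G : Sym2 (TorusSite 2 L) → ℝ := Sym2.lift ⟨fun x y => (1 / 4 : ℝ) *
      ∑ σ : TensorIndex (TorusSite 2 L) 2, (if σ x ≠ σ y then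
        a σ * a (σ ∘ Equiv.swap x y) * ‖u σ - u (σ ∘ Equiv.swap x y)‖ ^ 2 else 0),
      fun x y => by simp only [ne_comm, Equiv.swap_comm]⟩ with hG
  have hq : (star φ ⬝ᵥ ((hcbHamiltonian L Δ - ((E₀ : ℝ) : ℂ) • (1 : Op (TorusSite 2 L) 2)) *ᵥ φ)).re
      = ∑ e ∈ (torusGraph 2 L).edgeFinset, G e := by
    rw [shiftedForm_re, hG]
    exact xxz_groundStateTransform (torusGraph 2 L) Δ a E₀ ha.eigen u φ hφu
  rw [hq, ← sum_bond_eq_sum_edge hL G]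
  unfold dirichletEnergy
  rw [← Finset.sum_add_distrib]
  refine Finset.sum_congr rfl fun p _ => ?_
  show G _ = bondDirichlet a _ _ _ + bondDirichlet a _ _ _
  rw [hG, Sym2.lift_mk]
  unfold bondDirichlet
  rw [← mul_add, ← Finset.sum_add_distrib]
  refine congrArg (fun z : ℝ => (1 / 4 : ℝ) * z) ?_
  refine Finset.sum_congr rfl fun σ _ => ?_
  split_ifs
  · rw [norm_sub_sq_re_im]; ring
  · simp

/-- **General sector test vectors: the current form splits as `⟨φ, J^j_0 ψ⟩ = B_j(Re u) − i B_j(Im u)`**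
(`L ≥ 2`). [folklore] -/
theorem currentForm_eq_pairing_re_im (hL : 2 ≤ L) (Δ M : ℝ) (a : TensorIndex (TorusSite 2 L) 2 → ℝ)
    (ha : IsPerronSectorGroundAmplitude L Δ M a) (φ : TensorIndex (TorusSite 2 L) 2 → ℂ)
    (hφ : φ ∈ spinZSector (Λ := TorusSite 2 L) 1 M) (j : Fin 2) :
    star φ ⬝ᵥ (currentMode L 0 j *ᵥ toC L a)
      = (windingPairing a j (fun σ => (φ σ / (a σ : ℂ)).re) : ℂ)
        - I * (windingPairing a j (fun σ => (φ σ / (a σ : ℂ)).im) : ℂ) := by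
  set u : TensorIndex (TorusSite 2 L) 2 → ℂ := fun σ => φ σ / (a σ : ℂ) with hu
  have hφu : ∀ σ, φ σ = u σ * (a σ : ℂ) := fun σ => sector_eq_mul_perron Δ M a ha φ hφ σ
  have hconj : ∀ τ, conj (u τ) = ((u τ).re : ℂ) - I * ((u τ).im : ℂ) := by
    intro τ
    apply Complex.ext <;> simp
  have hre : (fun σ => (φ σ / (a σ : ℂ)).re) = fun σ => (u σ).re := rfl
  have him : (fun σ => (φ σ / (a σ : ℂ)).im) = fun σ => (u σ).im := rfl
  rw [hre, him]
  unfold currentMode windingPairing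
  rw [Matrix.sum_mulVec, dotProduct_sum, Complex.ofReal_sum, Complex.ofReal_sum, Finset.mul_sum,
    ← Finset.sum_sub_distrib]
  refine Finset.sum_congr rfl fun x _ => ?_
  have hxy : x ≠ x + Pi.single j 1 := Ne.symm (add_single_ne_self hL x j)
  rw [Matrix.smul_mulVec, dotProduct_smul, smul_eq_mul,
    Summit.HubbardSuperconductivity.HubbardSuperconductivity.Theorems.AnisotropyChord.InsertionEntropy.torusPhase_zero_left,
    one_mul]
  unfold toC
  rw [bondCurrentForm_symm hxy a u φ hφu]
  unfold bondPairing
  rw [Complex.ofReal_mul, Complex.ofReal_sum, Complex.ofReal_mul, Complex.ofReal_sum]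
  simp only [Finset.mul_sum]
  rw [← Finset.sum_sub_distrib]
  refine Finset.sum_congr rfl fun σ _ => ?_
  rw [hconj, hconj]
  unfold orient
  have fin2 : ∀ t : Fin 2, t = 0 ∨ t = 1 := by decide
  rcases fin2 (σ x) with hx | hx <;> rcases fin2 (σ (x + Pi.single j 1)) with hy | hy <;>
    simp [hx, hy] <;> ring

/-- **THE CONVERSE (fixed `L ≥ 3`): the winding-energy floor for all real potentials gives back the φ-form
twist stiffness at the same level** — so `Υ^j L² = ⟨−T_j⟩ − 2m₋₁(J^j_0) = 2 min_g W_j(a; g)` EXACTLY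
(the twist stiffness IS the winding conductance of the Doob network). [folklore] -/
theorem variational_of_windingEnergy_ge (hL : 3 ≤ L) (Δ M : ℝ) (a : TensorIndex (TorusSite 2 L) 2 → ℝ)
    (ha : IsPerronSectorGroundAmplitude L Δ M a) (j : Fin 2) (Υ : ℝ)
    (hW : ∀ g : TensorIndex (TorusSite 2 L) 2 → ℝ, Υ / 2 ≤ windingEnergy a j g) :
    Υ ≤ kineticExpect L a j ∧
      ∀ φ : TensorIndex (TorusSite 2 L) 2 → ℂ, φ ∈ spinZSector (Λ := TorusSite 2 L) 1 M →
        2 * ‖star φ ⬝ᵥ (currentMode L 0 j *ᵥ toC L a)‖ ^ 2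
          ≤ (kineticExpect L a j - Υ) * (star φ ⬝ᵥ ((hcbHamiltonian L Δ
                - ((lowestEnergyInSector 1 (hcbHamiltonian L Δ) M : ℝ) : ℂ) • (1 : Op (TorusSite 2 L) 2)) *ᵥ φ)).re := by
  have hK := le_kineticExpect_of_floor (by omega) a j Υ hW
  refine ⟨hK, fun φ hφ => ?_⟩
  rw [currentForm_eq_pairing_re_im (by omega) Δ M a ha φ hφ j, shiftedForm_eq_dirichlet_re_im hL Δ M a ha φ hφ]
  set Bf := windingPairing a j (fun σ => (φ σ / (a σ : ℂ)).re)
  set Bh := windingPairing a j (fun σ => (φ σ / (a σ : ℂ)).im)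
  have hnorm : ‖(Bf : ℂ) - I * (Bh : ℂ)‖ ^ 2 = Bf ^ 2 + Bh ^ 2 := by
    rw [Complex.sq_norm, Complex.normSq_apply]
    simp
    ring
  rw [hnorm]
  have hf := pairing_sq_le_of_floor (by omega) a j Υ hW (fun σ => (φ σ / (a σ : ℂ)).re)
  have hh := pairing_sq_le_of_floor (by omega) a j Υ hW (fun σ => (φ σ / (a σ : ℂ)).im)
  nlinarith [hf, hh]

/-- **THE EXACT DICTIONARY: `DoobWindingStiffness Δ M ↔ VariationalTwistStiffness Δ M`.** [folklore] -/
theorem doobWindingStiffness_iff_variational (Δ : ℝ) (M : ℕ → ℝ) :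
    DoobWindingStiffness Δ M ↔ VariationalTwistStiffness Δ M := by
  refine ⟨fun h => ?_, doobWindingStiffness_of_variational Δ M⟩
  obtain ⟨Υ₀, hΥ₀, hev⟩ := h
  refine ⟨Υ₀, hΥ₀, ?_⟩
  filter_upwards [hev, eventually_ge_atTop 3] with L hL h3
  intro _ a ha j
  have hW : ∀ g : TensorIndex (TorusSite 2 L) 2 → ℝ, Υ₀ * (L : ℝ) ^ 2 / 2 ≤ windingEnergy a j g :=
    fun g => hL a ha j g
  exact variational_of_windingEnergy_ge h3 Δ (M L - 1) a ha j _ hW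

/-- The `N`-sector twin of the dictionary. [folklore] -/
theorem doobWindingStiffnessN_iff_variationalN (Δ : ℝ) (M : ℕ → ℝ) :
    DoobWindingStiffnessN Δ M ↔ VariationalTwistStiffnessN Δ M := by
  refine ⟨fun h => ?_, doobWindingStiffnessN_of_variationalN Δ M⟩
  obtain ⟨Υ₀, hΥ₀, hev⟩ := h
  refine ⟨Υ₀, hΥ₀, ?_⟩
  filter_upwards [hev, eventually_ge_atTop 3] with L hL h3
  intro _ a ha j
  have hW : ∀ g : TensorIndex (TorusSite 2 L) 2 → ℝ, Υ₀ * (L : ℝ) ^ 2 / 2 ≤ windingEnergy a j g :=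
    fun g => hL a ha j g
  exact variational_of_windingEnergy_ge h3 Δ (M L) a ha j _ hW

end Summit.HubbardSuperconductivity.HubbardSuperconductivity.Theorems.AnisotropyChord.Stiffness.Doob
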